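import Summits.Ventures.PercRepro.Night2FourFatCells

/-!
# PercRepro — the `(7, 5)` cells `(3, 1)` at `|G| = 16, 17` and `(3, 0)` at `|G| = 13` through three disjoint fat
hyperplanes, and the residues K (night-2, gen 23)

The three-disjoint-hyperplane count (`Night2ThreeFatCount`) with the chord excess of gen 20 gives the count sums
`1.509` at `(3, 1)`, `n = 15`, `1.893` at `n = 16` and `1.255` at `(3, 0)`, `n = 13`: those three cells (closed so far
only modulo `MeetingFat` / `NestedFat`) also close whenever three fat thin members miss pairwise disjoint sets.
**`shadowHall_seven_five_of_residuesK`** — the `(7, 5)` shadow row for every finite matroid modulo the residues J with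
the clause `NoThreeDisjointFat N G 2` extended to the WHOLE `(3, 1)` range `11 ≤ |G| ≤ 17` and to `(3, 0)`,
`|G| ∈ {10, 12, 13}`.
-/

namespace PercRepro.Shadow

open Finset PerFlat ThmH

/-- The count sum of the cell `(3, 1)` at `n = 15` with the three-disjoint-hyperplane count and `E = 5 / 24`:
`1.509 ≥ 1`. -/
theorem countSum_three_one_fifteen_d3 :
    1 ≤ countSum 15 5 3 (cPrimeDGP 5 3 5 1 2) (5 / 24 : ℚ) (cntDisjThree 5) := by
  rw [cPrimeDGP_three_one_two]
  unfold countSum DGenP.cjG cntDisjThree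
  rw [show Finset.Icc 1 (15 - 5) = {1, 2, 3, 4, 5, 6, 7, 8, 9, 10} by decide]
  repeat rw [Finset.sum_insert (by decide)]
  rw [Finset.sum_singleton]
  norm_num [Nat.choose_eq_descFactorial_div_factorial, Nat.descFactorial, Nat.factorial]

/-- The count sum of the cell `(3, 1)` at `n = 16` with the three-disjoint-hyperplane count and `E = 349 / 1800`:
`1.893 ≥ 1`. -/
theorem countSum_three_one_sixteen_d3 :
    1 ≤ countSum 16 5 3 (cPrimeDGP 5 3 5 1 2) (349 / 1800 : ℚ) (cntDisjThree 5) := by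
  rw [cPrimeDGP_three_one_two]
  unfold countSum DGenP.cjG cntDisjThree
  rw [show Finset.Icc 1 (16 - 5) = {1, 2, 3, 4, 5, 6, 7, 8, 9, 10, 11} by decide]
  repeat rw [Finset.sum_insert (by decide)]
  rw [Finset.sum_singleton]
  norm_num [Nat.choose_eq_descFactorial_div_factorial, Nat.descFactorial, Nat.factorial]

/-- The count sum of the cell `(3, 0)` at `n = 13` with the three-disjoint-hyperplane count and `E = 38 / 165`:
`1.255 ≥ 1`. -/
theorem countSum_three_zero_thirteen_d3 :
    1 ≤ countSum 13 6 3 (cPrimeDGP 5 3 6 0 2) (38 / 165 : ℚ) (cntDisjThree 6) := by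
  rw [cPrimeDGP_three_zero_two]
  unfold countSum DGenP.cjG cntDisjThree
  rw [show Finset.Icc 1 (13 - 6) = {1, 2, 3, 4, 5, 6, 7} by decide]
  repeat rw [Finset.sum_insert (by decide)]
  rw [Finset.sum_singleton]
  norm_num [Nat.choose_eq_descFactorial_div_factorial, Nat.descFactorial, Nat.factorial]

variable {α : Type*} [DecidableEq α] {M : Matroid α} [M.Finite]

open scoped Classical in
/-- **The cell `(3, 1)` at `|G| = 16` with three fat thin members missing pairwise DISJOINT sets** (`≤ 2` points each):
(LI_G) through the three-disjoint-hyperplane count of the covering bases. -/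
theorem localShadowHall_three_one_five_sixteen_of_threeDisjoint {G : Finset α} (hG : G ∈ flatsQ M (5 + 1))
    (hd : (gr M \ G).card = 3) (hk : kColoops M G = 1)
    (hs : ∀ e ∈ gr M, ∀ f ∈ gr M, e ≠ f → rkN M {e, f} = 2) (hl : ∀ e ∈ gr M, M.Indep {e})
    (hn : G.card = 16) {B₀ B₁ B₂ : Finset α} (hB₀ : B₀ ∈ thinMembers M 5 G) (hB₁ : B₁ ∈ thinMembers M 5 G)
    (hB₂ : B₂ ∈ thinMembers M 5 G)
    (hfat₀ : (G \ clF M B₀).card ≤ 2) (hfat₁ : (G \ clF M B₁).card ≤ 2) (hfat₂ : (G \ clF M B₂).card ≤ 2)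
    (hd₀₁ : (G \ clF M B₀) ∩ (G \ clF M B₁) = ∅) (hd₀₂ : (G \ clF M B₀) ∩ (G \ clF M B₂) = ∅)
    (hd₁₂ : (G \ clF M B₁) ∩ (G \ clF M B₂) = ∅) :
    LocalShadowHall M 5 G := by
  have hk' : kColoops M G + 5 = 5 + 1 := by omega
  have hd' : (gr M \ G).card ≤ 5 := by omega
  have hm2 : ∀ B ∈ thinMembers M 5 G, 5 ≤ (B \ coloops M G).card → 2 ≤ (G \ clF M B).card :=
    fun B hB _ => two_le_card_sdiff_of_not_lay0 hG hd' (mem_thinMembers.1 hB).1 (mem_thinMembers.1 hB).2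
  have hc2 : 0 ≤ cPrimeDGP 5 3 5 (kColoops M G) 2 := by
    rw [hk]; unfold cPrimeDGP capDG reqDGP phiQ; norm_num
  have hn' : G.card - kColoops M G = 15 := by omega
  have hKG : coloops M G ⊆ G := fun y hy => (mem_coloops.1 hy).1
  have hnK : (G \ coloops M G).card = 15 := by
    rw [Finset.card_sdiff_of_subset hKG, ← kColoops_eq_card_coloops]; omega
  refine localShadowHall_excess_of_count (d := 3) (ρ := 5) (m₁ := 2) hG hd (by norm_num) hk' (by norm_num)
    hs hl hc2 hm2 (E := (5 / 24 : ℚ)) (by norm_num) ?_ (cnt := cntDisjThree 5) ?_ ?_ ?_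
  · intro S _ T hT
    have hT' : T ∈ (S \ coloops M G).powersetCard 5 := by
      unfold coverBases at hT
      exact (Finset.mem_filter.1 hT).1
    have h := sum_faceLoss_union_le (a := (8 / 35 : ℚ)) (b := (1 / 70 : ℚ)) hG hd (by norm_num) hk' (by omega)
      hs hl (by norm_num) (by rw [hnK]; intro m h1 h2; exact DGenP.chord_three_one_15 m h1 (by omega))
      (by rw [hnK, hk, DGenP.excessBound_three_one_15]; norm_num) hT'
    rw [hnK, hk, DGenP.excessBound_three_one_15] at h
    exact h
  · intro s h1 h2
    rw [hn'] at h2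
    exact cntDisjThree_five_pos s h1 (by omega)
  · intro S hSG
    exact card_coverBases_le_cntDisjThree hk' (by norm_num) (coloops_subset_clF_of_mem_thinMembers hG hd' hB₀)
      (eRk_clF_le_of_mem_thinMembers hB₀) (coloops_subset_clF_of_mem_thinMembers hG hd' hB₁)
      (eRk_clF_le_of_mem_thinMembers hB₁) (coloops_subset_clF_of_mem_thinMembers hG hd' hB₂)
      (eRk_clF_le_of_mem_thinMembers hB₂) hfat₀ hfat₁ hfat₂ hd₀₁ hd₀₂ hd₁₂ hSG
  · rw [hn', hk]
    exact countSum_three_one_fifteen_d3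

open scoped Classical in
/-- **The cell `(3, 1)` at `|G| = 17` with three fat thin members missing pairwise DISJOINT sets** (`≤ 2` points each):
(LI_G) through the three-disjoint-hyperplane count of the covering bases. -/
theorem localShadowHall_three_one_five_seventeen_of_threeDisjoint {G : Finset α} (hG : G ∈ flatsQ M (5 + 1))
    (hd : (gr M \ G).card = 3) (hk : kColoops M G = 1)
    (hs : ∀ e ∈ gr M, ∀ f ∈ gr M, e ≠ f → rkN M {e, f} = 2) (hl : ∀ e ∈ gr M, M.Indep {e})
    (hn : G.card = 17) {B₀ B₁ B₂ : Finset α} (hB₀ : B₀ ∈ thinMembers M 5 G) (hB₁ : B₁ ∈ thinMembers M 5 G)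
    (hB₂ : B₂ ∈ thinMembers M 5 G)
    (hfat₀ : (G \ clF M B₀).card ≤ 2) (hfat₁ : (G \ clF M B₁).card ≤ 2) (hfat₂ : (G \ clF M B₂).card ≤ 2)
    (hd₀₁ : (G \ clF M B₀) ∩ (G \ clF M B₁) = ∅) (hd₀₂ : (G \ clF M B₀) ∩ (G \ clF M B₂) = ∅)
    (hd₁₂ : (G \ clF M B₁) ∩ (G \ clF M B₂) = ∅) :
    LocalShadowHall M 5 G := by
  have hk' : kColoops M G + 5 = 5 + 1 := by omega
  have hd' : (gr M \ G).card ≤ 5 := by omega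
  have hm2 : ∀ B ∈ thinMembers M 5 G, 5 ≤ (B \ coloops M G).card → 2 ≤ (G \ clF M B).card :=
    fun B hB _ => two_le_card_sdiff_of_not_lay0 hG hd' (mem_thinMembers.1 hB).1 (mem_thinMembers.1 hB).2
  have hc2 : 0 ≤ cPrimeDGP 5 3 5 (kColoops M G) 2 := by
    rw [hk]; unfold cPrimeDGP capDG reqDGP phiQ; norm_num
  have hn' : G.card - kColoops M G = 16 := by omega
  have hKG : coloops M G ⊆ G := fun y hy => (mem_coloops.1 hy).1
  have hnK : (G \ coloops M G).card = 16 := by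
    rw [Finset.card_sdiff_of_subset hKG, ← kColoops_eq_card_coloops]; omega
  refine localShadowHall_excess_of_count (d := 3) (ρ := 5) (m₁ := 2) hG hd (by norm_num) hk' (by norm_num)
    hs hl hc2 hm2 (E := (349 / 1800 : ℚ)) (by norm_num) ?_ (cnt := cntDisjThree 5) ?_ ?_ ?_
  · intro S _ T hT
    have hT' : T ∈ (S \ coloops M G).powersetCard 5 := by
      unfold coverBases at hT
      exact (Finset.mem_filter.1 hT).1
    have h := sum_faceLoss_union_le (a := (17 / 75 : ℚ)) (b := (1 / 75 : ℚ)) hG hd (by norm_num) hk' (by omega)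
      hs hl (by norm_num) (by rw [hnK]; intro m h1 h2; exact DGenP.chord_three_one_16 m h1 (by omega))
      (by rw [hnK, hk, DGenP.excessBound_three_one_16]; norm_num) hT'
    rw [hnK, hk, DGenP.excessBound_three_one_16] at h
    exact h
  · intro s h1 h2
    rw [hn'] at h2
    exact cntDisjThree_five_pos s h1 (by omega)
  · intro S hSG
    exact card_coverBases_le_cntDisjThree hk' (by norm_num) (coloops_subset_clF_of_mem_thinMembers hG hd' hB₀)
      (eRk_clF_le_of_mem_thinMembers hB₀) (coloops_subset_clF_of_mem_thinMembers hG hd' hB₁)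
      (eRk_clF_le_of_mem_thinMembers hB₁) (coloops_subset_clF_of_mem_thinMembers hG hd' hB₂)
      (eRk_clF_le_of_mem_thinMembers hB₂) hfat₀ hfat₁ hfat₂ hd₀₁ hd₀₂ hd₁₂ hSG
  · rw [hn', hk]
    exact countSum_three_one_sixteen_d3

open scoped Classical in
/-- **The cell `(3, 0)` at `|G| = 13` with three fat thin members missing pairwise DISJOINT sets** (`≤ 2` points each):
(LI_G) through the three-disjoint-hyperplane count of the covering bases. -/
theorem localShadowHall_three_zero_six_thirteen_of_threeDisjoint {G : Finset α} (hG : G ∈ flatsQ M (5 + 1))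
    (hd : (gr M \ G).card = 3) (hk : kColoops M G = 0)
    (hs : ∀ e ∈ gr M, ∀ f ∈ gr M, e ≠ f → rkN M {e, f} = 2) (hl : ∀ e ∈ gr M, M.Indep {e})
    (hn : G.card = 13) {B₀ B₁ B₂ : Finset α} (hB₀ : B₀ ∈ thinMembers M 5 G) (hB₁ : B₁ ∈ thinMembers M 5 G)
    (hB₂ : B₂ ∈ thinMembers M 5 G)
    (hfat₀ : (G \ clF M B₀).card ≤ 2) (hfat₁ : (G \ clF M B₁).card ≤ 2) (hfat₂ : (G \ clF M B₂).card ≤ 2)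
    (hd₀₁ : (G \ clF M B₀) ∩ (G \ clF M B₁) = ∅) (hd₀₂ : (G \ clF M B₀) ∩ (G \ clF M B₂) = ∅)
    (hd₁₂ : (G \ clF M B₁) ∩ (G \ clF M B₂) = ∅) :
    LocalShadowHall M 5 G := by
  have hk' : kColoops M G + 6 = 5 + 1 := by omega
  have hd' : (gr M \ G).card ≤ 5 := by omega
  have hm2 : ∀ B ∈ thinMembers M 5 G, 6 ≤ (B \ coloops M G).card → 2 ≤ (G \ clF M B).card :=
    fun B hB _ => two_le_card_sdiff_of_not_lay0 hG hd' (mem_thinMembers.1 hB).1 (mem_thinMembers.1 hB).2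
  have hc2 : 0 ≤ cPrimeDGP 5 3 6 (kColoops M G) 2 := by
    rw [hk]; unfold cPrimeDGP capDG reqDGP phiQ; norm_num
  have hn' : G.card - kColoops M G = 13 := by omega
  have hKG : coloops M G ⊆ G := fun y hy => (mem_coloops.1 hy).1
  have hnK : (G \ coloops M G).card = 13 := by
    rw [Finset.card_sdiff_of_subset hKG, ← kColoops_eq_card_coloops]; omega
  refine localShadowHall_excess_of_count (d := 3) (ρ := 6) (m₁ := 2) hG hd (by norm_num) hk' (by norm_num)
    hs hl hc2 hm2 (E := (38 / 165 : ℚ)) (by norm_num) ?_ (cnt := cntDisjThree 6) ?_ ?_ ?_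
  · intro S _ T hT
    have hT' : T ∈ (S \ coloops M G).powersetCard 6 := by
      unfold coverBases at hT
      exact (Finset.mem_filter.1 hT).1
    have h := sum_faceLoss_union_le (a := (13 / 55 : ℚ)) (b := (1 / 55 : ℚ)) hG hd (by norm_num) hk' (by omega)
      hs hl (by norm_num) (by rw [hnK]; intro m h1 h2; exact DGenP.chord_three_zero_13 m h1 (by omega))
      (by rw [hnK, hk, DGenP.excessBound_three_zero_13]; norm_num) hT'
    rw [hnK, hk, DGenP.excessBound_three_zero_13] at h
    exact h
  · intro s h1 h2
    rw [hn'] at h2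
    exact cntDisjThree_six_pos s h1 (by omega)
  · intro S hSG
    exact card_coverBases_le_cntDisjThree hk' (by norm_num) (coloops_subset_clF_of_mem_thinMembers hG hd' hB₀)
      (eRk_clF_le_of_mem_thinMembers hB₀) (coloops_subset_clF_of_mem_thinMembers hG hd' hB₁)
      (eRk_clF_le_of_mem_thinMembers hB₁) (coloops_subset_clF_of_mem_thinMembers hG hd' hB₂)
      (eRk_clF_le_of_mem_thinMembers hB₂) hfat₀ hfat₁ hfat₂ hd₀₁ hd₀₂ hd₁₂ hSG
  · rw [hn', hk]
    exact countSum_three_zero_thirteen_d3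

section SevenFiveK

variable {α' : Type} [DecidableEq α']

/-- **THE `(7, 5)` SHADOW ROW FOR EVERY FINITE MATROID MODULO THE RESIDUES K**: the residues of
`shadowHall_seven_five_of_residuesJ` with `NoThreeDisjointFat N G 2` on the whole `(3, 1)` range `11 ≤ |G| ≤ 17` and at
`(3, 0)`, `|G| ∈ {10, 12, 13}`. -/
theorem shadowHall_seven_five_of_residuesK
    (h20 : ∀ (N : Matroid α') [N.Finite] (G : Finset α'), CellHyp N G →
      (gr N \ G).card = 2 → kColoops N G = 0 → FatMember N G 6 3 →
      (FatBasis N G 6 2 ∨ FatMember N G 6 2) → LocalShadowHall N 5 G)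
    (h21 : ∀ (N : Matroid α') [N.Finite] (G : Finset α'), CellHyp N G →
      (gr N \ G).card = 2 → kColoops N G = 1 → FatMember N G 5 4 →
      (FatBasis N G 5 3 ∨ FatMember N G 5 3) → LocalShadowHall N 5 G)
    (h30 : ∀ (N : Matroid α') [N.Finite] (G : Finset α'), CellHyp N G →
      (gr N \ G).card = 3 → kColoops N G = 0 → 10 ≤ G.card → G.card ≤ 13 → FatMember N G 6 2 →
      FatBasis N G 6 2 → (G.card = 13 → NestedFat N G 2 3) →
      (G.card = 10 ∨ G.card = 12 ∨ G.card = 13 → NoThreeDisjointFat N G 2) →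
      (G.card = 11 → NoFourDisjointFat N G 2) → LocalShadowHall N 5 G)
    (h31 : ∀ (N : Matroid α') [N.Finite] (G : Finset α'), CellHyp N G →
      (gr N \ G).card = 3 → kColoops N G = 1 → 11 ≤ G.card → G.card ≤ 17 → FatMember N G 5 2 →
      (G.card = 17 → FatBasis N G 5 2) → (G.card = 17 → NestedFat N G 2 3) →
      (G.card = 16 → MeetingFat N G 2) → (11 ≤ G.card ∧ G.card ≤ 17 → NoThreeDisjointFat N G 2) →
      (G.card = 11 ∨ G.card = 15 ∨ G.card = 16 → FatBasis N G 5 3) →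
      (12 ≤ G.card ∧ G.card ≤ 14 → FatBasis N G 5 4) → LocalShadowHall N 5 G)
    (h32 : ∀ (N : Matroid α') [N.Finite] (G : Finset α'), CellHyp N G →
      (gr N \ G).card = 3 → kColoops N G = 2 → FatMember N G 4 2 → LocalShadowHall N 5 G)
    (M : Matroid α') [M.Finite] : ShadowHall M 7 5 (phiK 7 5) := by
  apply shadowHall_seven_five_of_residuesJ h20 h21 _ _ h32
  · intro N _ G hcell hd hk h10 h13 hfm hfb hnest hnd3 hnd4
    by_cases hnd : NoThreeDisjointFat N G 2
    · exact h30 N G hcell hd hk h10 h13 hfm hfb hnest (fun _ => hnd) hnd4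
    · by_cases hG13 : G.card = 13
      · unfold NoThreeDisjointFat at hnd
        push Not at hnd
        obtain ⟨B₀, hB₀, B₁, hB₁, B₂, hB₂, hf₀, hf₁, hf₂, hd₀₁, hd₀₂, hd₁₂⟩ := hnd
        exact localShadowHall_three_zero_six_thirteen_of_threeDisjoint hcell.2.2.2 hd hk hcell.1 hcell.2.1 hG13
          hB₀ hB₁ hB₂ hf₀ hf₁ hf₂ hd₀₁ hd₀₂ hd₁₂
      · refine h30 N G hcell hd hk h10 h13 hfm hfb hnest (fun h => hnd3 ?_) hnd4
        rcases h with h | h | h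
        · exact Or.inl h
        · exact Or.inr h
        · exact absurd h hG13
  · intro N _ G hcell hd hk h11 h17 hfm hb2 hnest hmeet hnd3 hb3 hb4
    by_cases hnd : NoThreeDisjointFat N G 2
    · exact h31 N G hcell hd hk h11 h17 hfm hb2 hnest hmeet (fun _ => hnd) hb3 hb4
    · unfold NoThreeDisjointFat at hnd
      push Not at hnd
      obtain ⟨B₀, hB₀, B₁, hB₁, B₂, hB₂, hf₀, hf₁, hf₂, hd₀₁, hd₀₂, hd₁₂⟩ := hnd
      by_cases hG16 : G.card = 16
      · exact localShadowHall_three_one_five_sixteen_of_threeDisjoint hcell.2.2.2 hd hk hcell.1 hcell.2.1 hG16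
          hB₀ hB₁ hB₂ hf₀ hf₁ hf₂ hd₀₁ hd₀₂ hd₁₂
      by_cases hG17 : G.card = 17
      · exact localShadowHall_three_one_five_seventeen_of_threeDisjoint hcell.2.2.2 hd hk hcell.1 hcell.2.1 hG17
          hB₀ hB₁ hB₂ hf₀ hf₁ hf₂ hd₀₁ hd₀₂ hd₁₂
      · exact h31 N G hcell hd hk h11 h17 hfm hb2 hnest hmeet (fun h => hnd3 ⟨h.1, by omega⟩) hb3 hb4

end SevenFiveK

end PercRepro.Shadow
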